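import Literature.AlgebraicGeometry.Morphisms.CechUnitCocycleDualNumbers
import Literature.AlgebraicGeometry.Morphisms.CechUnitCocycleModelData
import HarnessLib

/-!
# Unit Čech cocycles: `KS(D) = 0` ⟹ the lifts along `D` and along `0` have isomorphic pulled-back modules

Generic companion of `Morphisms/CechUnitCocycleDualNumbers` (the `A`-linear Kodaira–Spencer map
`ksLinear p ev : DerAt ev →ₗ[A] Ȟ¹(𝒰, 𝒪_X)` of transition data `p` over a chart ring `B` at an augmentation `ev`) and
`Morphisms/CechUnitCocycleModelData` (model data, REL ⟹ ISO):

* (γ8a) `exists_rel_map_constLift_derivLift_of_ksLinear_eq_zero` — if `KS_p(D) = 0` then the dual-number cocycles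
  `p.map (constLift ev)` and `p.map (derivLift ev D)` are related by a unit `0`-cochain reducing to `1` modulo `ε` (the
  difference class of the two lifts of `ev` along the dual-number small extension IS `KS_p(D)`,
  `diffClass_map_map_eq_ksLinear`, and a vanishing difference class is a coboundary, `exists_rel_of_diffClass_eq_zero`);
* (γ8b) `ModelData.Hom.cocycle_pullback_cast`, `ModelData.nonempty_iso_pullback_of_ksLinear_eq_zero` — through model data
  over `B` and over `A[ε]` on a covering family, `KS(D) = 0` gives an ISOMORPHISM `g_0^*M ≅ g_D^*M` of the pull-backs of a
  framed module `M` along the classifying maps of the two lifts (change of level + REL ⟹ ISO).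

This is the cocycle form of «the Kodaira–Spencer class of a first-order deformation of an invertible module vanishes iff the
deformation is trivial» ([GortzWedhorn2023] Prop. 27.122; [MumfordAV1970] §13, proof of the Theorem, pp. 125–130), used by
the cell hodgecm-mathlib (M13 node N3, γ8) to prove injectivity of the Kodaira–Spencer maps of the Artinian charts of the
Poincaré sheaf.  Author B-p07 (g12).  HC_CM is proved only modulo the 7 printed citations until rung 0 closes.

## References
* [GortzWedhorn2023] U. Görtz, T. Wedhorn, *Algebraic Geometry II* (2023), Lemma 26.15, Prop. 27.122.
* [MumfordAV1970] D. Mumford, *Abelian Varieties* (1970), §13 (proof of the Thm. pp. 125–130).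
* [Hartshorne1977] R. Hartshorne, *Algebraic Geometry*, III Ex. 4.5.
* The Stacks Project, Tag 02KG.
-/

noncomputable section

universe u v

open TensorProduct CategoryTheory AlgebraicGeometry
open Literature.RingTheory.Flat Literature.RingTheory.Flat.IsSmallExtension

namespace Literature.AlgebraicGeometry.Morphisms.CechUnitCocycle

open TrivSqZeroExt Literature.AlgebraicGeometry.Modules

/-! ### `KS(D) = 0` ⟹ the dual-number cocycles of the constant lift and of the lift along `D` are related -/

section G8a

variable {A : Type u} [CommRing A] {X : Scheme.{u}} {f : X ⟶ Spec (.of A)} {ι : Type v} {U : ι → X.Opens}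
  {B : Type u} [CommRing B] [Algebra A B]
  [∀ V : X.Opens, Module.Flat A (Sections f V)]

/-- **`KS_p(D) = 0` ⟹ `p.map (ev)` and `p.map (ev + εD)` are cohomologous over `A[ε]`** by a unit `0`-cochain
reducing to `1` modulo `ε` (the difference class of the two lifts `constLift ev`, `derivLift ev D` of `ev` along the
dual-number small extension IS `KS_p(D)`). [cite: GortzWedhorn2023, Prop. 27.122 (proof, `U[ε]`)]
[cite: MumfordAV1970, §13 (proof of the Thm. pp. 125–130)] -/
theorem exists_rel_map_constLift_derivLift_of_ksLinear_eq_zero (p : UCocycle f U B) (ev : B →ₐ[A] A)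
    (D : DerAt ev) (hD : ksLinear p ev D = 0) :
    ∃ h : UCochain0 f U (DualNumber A),
      (∀ i, coef f (fstHom A A A) (U i) (h i : Sections f (U i) ⊗[A] DualNumber A) = 1) ∧
      Rel (p.map (constLift ev)) (p.map (derivLift ev D.1 D.2))
        (fun i => (h i : Sections f (U i) ⊗[A] DualNumber A)) := by
  refine exists_rel_of_diffClass_eq_zero (dualNumber_isSmallExtension A) (dualNumber_hρ A) _ _
    (sameRed_map_map p (constLift ev) (derivLift ev D.1 D.2) (fst_comp_derivLift ev D.1 D.2)) fun ℓ => ?_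
  obtain rfl : ℓ = 0 := Subsingleton.elim _ _
  rw [diffClass_map_map_eq_ksLinear (dualNumber_isSmallExtension A) (dualNumber_hρ A) p (constLift ev)
    (derivLift ev D.1 D.2) (fst_comp_derivLift ev D.1 D.2) 0]
  have key : ∀ (e : B →ₐ[A] A) (_ : e = ev) (D' : B →ₗ[A] A) (hD' : D' ∈ DerAt e) (_ : D' = D.1),
      ksLinear p e ⟨D', hD'⟩ = 0 := by
    rintro e rfl D' hD' rfl
    exact hD
  exact key _ (fst_comp_constLift ev) _ _ (liftDiffCoord_derivLift ev D.1 D.2)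

end G8a

/-! ### REL ⟹ ISO through model data: `KS(D) = 0` ⟹ `g_0^*M ≅ g_D^*M` for the two classifying maps -/

section G8b

variable {A : Type u} [CommRing A] {X : Scheme.{u}} {f : X ⟶ Spec (.of A)} {ι : Type v} {U : ι → X.Opens}
  {R : Type u} [CommRing R] [Algebra A R] {Y : Scheme.{u}} {W : ι → Y.Opens}
  {R' : Type u} [CommRing R'] [Algebra A R'] {Y' : Scheme.{u}} {W' : ι → Y'.Opens}

/-- **Pulled-back frames, cast to the target cover, have model cocycle `(Φ.cocycle F).map ψ`** (the `cast` form
of `ModelData.Hom.cocycle_pullback`, as used by `ModelTower₂.cocycle_FM`). [cite: StacksProject, Tag 02KG] -/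
theorem ModelData.Hom.cocycle_pullback_cast {Φ : ModelData f U R Y W} {Φ' : ModelData f U R' Y' W'}
    {ψ : R →ₐ[A] R'} {g : Y' ⟶ Y} (hg : Φ.Hom Φ' ψ g) {M : Y.Modules} (F : IFrames M W) (a b : ι) :
    (Φ'.cocycle ((F.pullback g).cast (funext hg.preimage))).val a b = ((Φ.cocycle F).map ψ).val a b :=
  hg.cocycle_pullback F _ (fun a b => by
    rw [IFrames.tf_cast, IFrames.tf_pullback]
    change (g.appLE _ _ _ ≫ Y'.presheaf.map _) (F.tf a b) = _
    rw [Scheme.Hom.appLE_map]) a b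

variable {B : Type u} [CommRing B] [Algebra A B] {YB : Scheme.{u}} {WB : ι → YB.Opens}
  {Yε : Scheme.{u}} {Wε : ι → Yε.Opens}
  [∀ V : X.Opens, Module.Flat A (Sections f V)]

/-- **(γ8b) `KS(D) = 0` ⟹ `g_0^*M ≅ g_D^*M`** for a framed module `M` on the chart thickening `YB` («`X × Spec B`»),
model data `Φ` over `B` and `Φε` over `A[ε]` on a COVERING family, and classifying maps `g_0, g_D : Yε → YB` of the
constant lift and of the lift along `D` compatible with the model data (γ8a + change of level + REL ⟹ ISO).
[cite: MumfordAV1970, §13 (proof of the Thm. pp. 125–130)] [cite: Hartshorne1977, III Ex. 4.5] -/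
theorem ModelData.nonempty_iso_pullback_of_ksLinear_eq_zero (Φ : ModelData f U B YB WB)
    (Φε : ModelData f U (DualNumber A) Yε Wε) (hWε : iSup Wε = ⊤) {M : YB.Modules} (F : IFrames M WB)
    (ev : B →ₐ[A] A) (D : DerAt ev) {g₀ g₁ : Yε ⟶ YB} (hg₀ : Φ.Hom Φε (constLift ev) g₀)
    (hg₁ : Φ.Hom Φε (derivLift ev D.1 D.2) g₁) (hD : ksLinear (Φ.cocycle F) ev D = 0) :
    Nonempty ((Scheme.Modules.pullback g₀).obj M ≅ (Scheme.Modules.pullback g₁).obj M) := by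
  obtain ⟨h, -, hrel⟩ := exists_rel_map_constLift_derivLift_of_ksLinear_eq_zero (Φ.cocycle F) ev D hD
  refine Φε.nonempty_iso_of_rel hWε ((F.pullback g₀).cast (funext hg₀.preimage))
    ((F.pullback g₁).cast (funext hg₁.preimage)) (fun i => (h i : Sections f (U i) ⊗[A] DualNumber A))
    (fun i => (h i).isUnit) fun a b => ?_
  rw [hg₀.cocycle_pullback_cast, hg₁.cocycle_pullback_cast]
  exact hrel a b

end G8b

end Literature.AlgebraicGeometry.Morphisms.CechUnitCocycle

end
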